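import Summits.Schanuel.Schanuel.Theses.PolarPhantoms
import Literature.NumberTheory.Transcendental.RoyCriterionProofs
import Literature.NumberTheory.Transcendental.LindemannWeierstrassProofs

/-!
# Refutation of `PolarPhantoms.PolarSchanuel` (route `PolarPhantoms`, target, stmt-Schanuel-6844)

**Specialisation collapse.** Let `ω ∈ ℂ` be transcendental (we take `ω = π`,
`Literature.NumberTheory.Transcendental.transcendental_pi_holds`) and consider the point
`n = 2`, `y = (ω, ω²)`, `α = (1 + ω, 1 − ω)`.  Its hypotheses in `PolarSchanuel` hold:
`y` is `ℚ`-linearly independent, `α ∈ (ℂˣ)²`, `trdeg_ℚ ℚ(y, α) = trdeg ℚ(ω) = 1 < 2`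
(and `α` is multiplicatively independent, `α_j e^{-y_j}` is not a root of unity — the point is
as non-degenerate as a point of transcendence degree `1` can be).  Every Roy box value
`(D^k P)(m₀ω + m₁ω², (1+ω)^{m₀}(1−ω)^{m₁})` is `V_{k,m}(ω)` for a polynomial `V_{k,m} ∈ ℚ[X]`
with `V_{k,m}(0) = (D^k P)(0, 1)` — independent of `m`: under `X ↦ 0` the whole multi-orbit
collapses onto the rank-`0` exponential point `(0, e^0)`.  A certificate
`∑ c_{k,m} V_{k,m}(ω) = z ∈ ℤ` with `c_{k,m} ∈ ℚ` is, by transcendence of `ω`, the polynomial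
identity `∑ c_{k,m} V_{k,m} = z` in `ℚ[X]`; at `X = 0` it reads `z = ∑ c_{k,m} (D^k P)(0,1)`.
Roy's auxiliary polynomials at the exponential point `y' = 0 ∈ ℂ²` (the tree's
`royHypothesis_exp'`, unconditional, every admissible parameter set, all large `N`) give
`P_N ≠ 0` in the box with `|(D^k P_N)(0,1)| ≤ e^{-N^u}` for `k ≤ N^{s₀}`, so every certificate
of `P_N` has `|z| ≤ ‖c‖₁ e^{-N^u}`: a cheap one (`‖c‖₁ < e^{N^u}`) forces `z = 0`.  Hence at
this point NO admissible parameter set admits cheap certificates for infinitely many `N`, and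
`PolarSchanuel` is false.
-/

noncomputable section

namespace Summit.Schanuel.Schanuel.Theorems

open MvPolynomial Filter Complex Finset
open scoped Polynomial
open Literature.NumberTheory.Transcendental

/-- Refutes `PolarPhantoms.PolarSchanuel` [refuted-substantive]: the route target X ("at every
point `(y, α)` with `y` `ℚ`-linearly independent, `α ∈ (ℂˣ)ⁿ`, `trdeg ℚ(y,α) < n`, some
admissible parameter set gives cheap exact certificates on Roy's box for infinitely many `N`")
fails at the point `n = 2`, `y = (π, π²)`, `α = (1 + π, 1 − π)` (trdeg `1`; `α` multiplicatively
independent and `α_j e^{-y_j}` not a root of unity): the specialisation `π ↦ 0` of `ℤ[π]`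
collapses the whole multi-orbit `(m·y, α^m)` onto the exponential point `(0, e⁰)`, where Roy's
own auxiliary polynomials (`royHypothesis_exp'`, every admissible parameter set, all large `N`)
have all box values `≤ e^{-N^u}`; a rational certificate `∑ c v = z ∈ ℤ ∖ 0` survives the
specialisation (transcendence of `π`), so `|z| ≤ ‖c‖₁ e^{-N^u} < 1`.  Witness works verbatim for
every transcendental `ω` in place of `π` and every polynomial point `y = Y(ω)`, `α = A(ω)` with
`Y(0) = 0`, `A(0) = 1` (inner `noCheap`).  No cheap repair: the witness pattern is "any point whose
coordinate ring `ℤ[y, α^{±1}]` specialises onto a configuration `(y', ζ e^{y'})`"; a would-be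
Schanuel counterexample `(y, e^y)` has the identity as such a specialisation, so every hypothesis
excluding the witnesses also excludes the points X must cover for `closes` (X restricted to
exponential points is, by `PolarGlue`, Schanuel itself), while keeping `trdeg < n` non-exponential
points in scope keeps the witnesses (tried: `α` multiplicatively independent — this witness;
`α_j e^{-y_j} ∉ μ_∞` — this witness; no rational / algebraic coordinate pair — this witness).
barrier-candidate: specialisation collapse — non-existence of (cheap or exact) rational
certificates on Roy boxes is inherited from every specialisation of the point, so no exp-free
"∀ points of trdeg < n" certificate statement in Roy's window (`s₀ < t₀ + t₁`: single jets are
Thue–Siegel) can hold. [folklore] -/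
theorem PolarPhantomsPolarSchanuel_refuted :
    ¬ Summit.Schanuel.Schanuel.Theses.PolarPhantoms.PolarSchanuel := by
  /- (1) A ring map commutes with the evaluation of an integer polynomial in two variables. -/
  have map_eval₂ : ∀ {A B G : Type} [CommRing A] [CommRing B] [FunLike G A B]
      [RingHomClass G A B] (φ : G) (F : Fin 2 → A) (Q : MvPolynomial (Fin 2) ℤ),
      φ (MvPolynomial.eval₂ (Int.castRingHom A) F Q) =
        MvPolynomial.eval₂ (Int.castRingHom B) (fun i => φ (F i)) Q := by
    intro A B G _ _ _ _ φ F Q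
    have h := MvPolynomial.hom_eval₂ Q (Int.castRingHom A) (φ : A →+* B) F
    rw [RingHom.eq_intCast' ((φ : A →+* B).comp (Int.castRingHom A))] at h
    simpa using h
  /- (2) No cheap certificates at a collapsing polynomial point: if `y_j = Y_j(ω)`, `α_j = A_j(ω)`
  for a transcendental `ω` and `Y_j, A_j ∈ ℚ[X]` with `Y_j(0) = 0`, `A_j(0) = 1`, then for every
  admissible parameter set the Roy boxes at `(y, α)` do NOT admit cheap exact certificates for
  infinitely many `N` (specialise `X ↦ 0` onto the exponential point `(0, 1)` and use
  `royHypothesis_exp'`). -/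
  have noCheap : ∀ {n : ℕ} (ω : ℂ), Transcendental ℚ ω →
      ∀ (Y A : Fin n → ℚ[X]), (∀ j, (Y j).eval 0 = 0) → (∀ j, (A j).eval 0 = 1) →
      ∀ (y α : Fin n → ℂ), (∀ j, y j = Polynomial.aeval ω (Y j)) →
      (∀ j, α j = Polynomial.aeval ω (A j)) →
      ∀ {s₀ s₁ t₀ t₁ u : ℝ}, RoyAdmissible s₀ s₁ t₀ t₁ u →
      ¬ ∃ᶠ N : ℕ in atTop, ∀ P : MvPolynomial (Fin 2) ℤ, P ≠ 0 →
        (P.degreeOf 0 : ℝ) ≤ (N : ℝ) ^ t₀ → (P.degreeOf 1 : ℝ) ≤ (N : ℝ) ^ t₁ →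
        (mvPolyHeight P : ℝ) ≤ Real.exp (N : ℝ) →
        ∃ c : ℕ → (Fin n → ℕ) → ℚ,
          (∑ k ∈ range (⌊(N : ℝ) ^ s₀⌋₊ + 1),
            ∑ m ∈ Fintype.piFinset (fun _ : Fin n => range (⌊(N : ℝ) ^ s₁⌋₊ + 1)),
              |(c k m : ℝ)|) < Real.exp ((N : ℝ) ^ u) ∧
          ∃ z : ℤ, z ≠ 0 ∧
            (∑ k ∈ range (⌊(N : ℝ) ^ s₀⌋₊ + 1),
              ∑ m ∈ Fintype.piFinset (fun _ : Fin n => range (⌊(N : ℝ) ^ s₁⌋₊ + 1)),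
                (c k m : ℂ) * MvPolynomial.aeval ![∑ j, ((m j : ℕ) : ℂ) * y j, ∏ j, α j ^ (m j)]
                  (royD^[k] P)) = (z : ℂ) := by
    intro n ω hω Y A hY hA y α hy hα s₀ s₁ t₀ t₁ u hadm hfreq
    have hroy : RoyHypothesis (0 : Fin n → ℂ) (cexp ∘ (0 : Fin n → ℂ)) s₀ s₁ t₀ t₁ u :=
      royHypothesis_exp' (0 : Fin n → ℂ) hadm
    refine Filter.frequently_false (atTop : Filter ℕ) (hfreq.mp (hroy.mono fun N hN hgood => ?_))
    obtain ⟨P, hP0, hd0, hd1, hH, hsmall⟩ := hN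
    obtain ⟨c, hcost, z, hz, hsum⟩ := hgood P hP0 hd0 hd1 hH
    -- the generic (polynomial) box point over `ℚ[X]`
    obtain ⟨F, hF⟩ : ∃ F : (Fin n → ℕ) → Fin 2 → ℚ[X],
        ∀ m, F m = ![∑ j, ((m j : ℕ) : ℚ[X]) * Y j, ∏ j, A j ^ (m j)] := ⟨_, fun _ => rfl⟩
    have hpt : ∀ m : Fin n → ℕ, (fun i => Polynomial.aeval ω (F m i)) =
        ![∑ j, ((m j : ℕ) : ℂ) * y j, ∏ j, α j ^ (m j)] := by
      intro m; funext i
      fin_cases i <;> simp [hF, map_sum, map_prod, hy, hα]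
    -- the polynomials `V k m ∈ ℚ[X]` whose value at `ω` is the box value
    obtain ⟨V, hV⟩ : ∃ V : ℕ → (Fin n → ℕ) → ℚ[X],
        ∀ k m, V k m = MvPolynomial.eval₂ (Int.castRingHom ℚ[X]) (F m) (royD^[k] P) :=
      ⟨_, fun _ _ => rfl⟩
    have hval : ∀ (k : ℕ) (m : Fin n → ℕ),
        MvPolynomial.aeval ![∑ j, ((m j : ℕ) : ℂ) * y j, ∏ j, α j ^ (m j)] (royD^[k] P) =
          Polynomial.aeval ω (V k m) := by
      intro k m
      rw [MvPolynomial.aeval_def, RingHom.eq_intCast' (algebraMap ℤ ℂ), hV,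
        map_eval₂, hpt m]
    have hpt0 : ∀ m : Fin n → ℕ, (fun i => Polynomial.aeval (0 : ℚ) (F m i)) = ![(0 : ℚ), 1] := by
      intro m; funext i
      fin_cases i <;> simp [hF, hY, hA]
    -- the rational numbers `w k = (D^k P)(0, 1)`
    obtain ⟨w, hw⟩ : ∃ w : ℕ → ℚ,
        ∀ k, w k = MvPolynomial.eval₂ (Int.castRingHom ℚ) ![(0 : ℚ), 1] (royD^[k] P) :=
      ⟨_, fun _ => rfl⟩
    have hval0 : ∀ (k : ℕ) (m : Fin n → ℕ), Polynomial.aeval (0 : ℚ) (V k m) = w k := by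
      intro k m
      rw [hV, map_eval₂, hpt0 m, hw]
    have hwC : ∀ k, ((w k : ℚ) : ℂ) = MvPolynomial.aeval ![(0 : ℂ), 1] (royD^[k] P) := by
      intro k
      have h := map_eval₂ (Rat.castHom ℂ) ![(0 : ℚ), 1] (royD^[k] P)
      have h2 : (fun i => (Rat.castHom ℂ) ((![(0 : ℚ), 1] : Fin 2 → ℚ) i)) = ![(0 : ℂ), 1] := by
        funext i; fin_cases i <;> simp
      rw [h2, Rat.coe_castHom, ← hw] at h
      rw [MvPolynomial.aeval_def, RingHom.eq_intCast' (algebraMap ℤ ℂ), ← h]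
    -- smallness of `w k` on the box, from Roy's auxiliary polynomial at the collapsed point
    have hsmallw : ∀ k ∈ range (⌊(N : ℝ) ^ s₀⌋₊ + 1), |(w k : ℝ)| ≤ Real.exp (-(N : ℝ) ^ u) := by
      intro k hk
      have hk' : (k : ℝ) ≤ (N : ℝ) ^ s₀ :=
        (Nat.le_floor_iff (by positivity)).mp (Nat.lt_succ_iff.mp (Finset.mem_range.mp hk))
      have h := hsmall k (fun _ => 0) hk' (fun j => by simp only [Nat.cast_zero]; positivity)
      have hp : (![∑ j, (((fun _ => 0 : Fin n → ℕ) j : ℕ) : ℂ) * (0 : Fin n → ℂ) j,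
          ∏ j, (cexp ∘ (0 : Fin n → ℂ)) j ^ ((fun _ => 0 : Fin n → ℕ) j)] : Fin 2 → ℂ) =
          ![(0 : ℂ), 1] := by
        simp
      rw [hp, ← hwC k, Complex.norm_ratCast] at h
      exact h
    -- the certificate is a polynomial identity in `ℚ[X]`
    have hinj : Function.Injective (Polynomial.aeval ω : ℚ[X] →ₐ[ℚ] ℂ) :=
      transcendental_iff_injective.mp hω
    obtain ⟨W, hW⟩ : ∃ W : ℚ[X], W = ∑ k ∈ range (⌊(N : ℝ) ^ s₀⌋₊ + 1),
        ∑ m ∈ Fintype.piFinset (fun _ : Fin n => range (⌊(N : ℝ) ^ s₁⌋₊ + 1)),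
          c k m • V k m := ⟨_, rfl⟩
    have hWω : Polynomial.aeval ω W = (z : ℂ) := by
      rw [← hsum, hW, map_sum]
      refine Finset.sum_congr rfl fun k _ => ?_
      rw [map_sum]
      refine Finset.sum_congr rfl fun m _ => ?_
      rw [map_smul, hval k m, Algebra.smul_def, eq_ratCast]
    have hWC : W = Polynomial.C (z : ℚ) := by
      apply hinj
      rw [hWω, Polynomial.aeval_C, eq_ratCast, Rat.cast_intCast]
    -- evaluate the identity at `X = 0`
    have hz_eq : (z : ℚ) = ∑ k ∈ range (⌊(N : ℝ) ^ s₀⌋₊ + 1),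
        ∑ m ∈ Fintype.piFinset (fun _ : Fin n => range (⌊(N : ℝ) ^ s₁⌋₊ + 1)), c k m * w k := by
      have h := congrArg (Polynomial.aeval (0 : ℚ)) hWC
      rw [Polynomial.aeval_C, Algebra.algebraMap_self, RingHom.id_apply] at h
      rw [← h, hW, map_sum]
      refine Finset.sum_congr rfl fun k _ => ?_
      rw [map_sum]
      refine Finset.sum_congr rfl fun m _ => ?_
      rw [map_smul, hval0 k m, smul_eq_mul]
    -- the final estimate `|z| < 1`
    have hzR : |(z : ℝ)| < 1 := by
      have h1 : (z : ℝ) = ∑ k ∈ range (⌊(N : ℝ) ^ s₀⌋₊ + 1),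
          ∑ m ∈ Fintype.piFinset (fun _ : Fin n => range (⌊(N : ℝ) ^ s₁⌋₊ + 1)),
            (c k m : ℝ) * (w k : ℝ) := by
        have h2 := congrArg (fun q : ℚ => (q : ℝ)) hz_eq
        simp only [Rat.cast_intCast, Rat.cast_sum, Rat.cast_mul] at h2
        exact h2
      rw [h1]
      calc |∑ k ∈ range (⌊(N : ℝ) ^ s₀⌋₊ + 1),
            ∑ m ∈ Fintype.piFinset (fun _ : Fin n => range (⌊(N : ℝ) ^ s₁⌋₊ + 1)),
              (c k m : ℝ) * (w k : ℝ)|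
          ≤ ∑ k ∈ range (⌊(N : ℝ) ^ s₀⌋₊ + 1),
            ∑ m ∈ Fintype.piFinset (fun _ : Fin n => range (⌊(N : ℝ) ^ s₁⌋₊ + 1)),
              |(c k m : ℝ)| * Real.exp (-(N : ℝ) ^ u) := by
            refine (Finset.abs_sum_le_sum_abs _ _).trans (Finset.sum_le_sum fun k hk => ?_)
            refine (Finset.abs_sum_le_sum_abs _ _).trans (Finset.sum_le_sum fun m _ => ?_)
            rw [abs_mul]
            exact mul_le_mul_of_nonneg_left (hsmallw k hk) (abs_nonneg _)
        _ = (∑ k ∈ range (⌊(N : ℝ) ^ s₀⌋₊ + 1),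
            ∑ m ∈ Fintype.piFinset (fun _ : Fin n => range (⌊(N : ℝ) ^ s₁⌋₊ + 1)),
              |(c k m : ℝ)|) * Real.exp (-(N : ℝ) ^ u) := by
            rw [Finset.sum_mul]
            refine Finset.sum_congr rfl fun k _ => ?_
            rw [Finset.sum_mul]
        _ < Real.exp ((N : ℝ) ^ u) * Real.exp (-(N : ℝ) ^ u) :=
            mul_lt_mul_of_pos_right hcost (Real.exp_pos _)
        _ = 1 := by rw [← Real.exp_add, add_neg_cancel, Real.exp_zero]
    have hz1 : (1 : ℝ) ≤ |(z : ℝ)| := by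
      rw [← Int.cast_abs]
      exact_mod_cast Int.one_le_abs hz
    linarith
  /- (3) The witness point `y = (ω, ω²)`, `α = (1 + ω, 1 − ω)` with `ω = π`. -/
  intro hX
  have hω : Transcendental ℚ ((Real.pi : ℝ) : ℂ) :=
    (transcendental_algebraMap_iff (R := ℚ) (A := ℂ) Complex.ofReal_injective).mpr
      transcendental_pi_holds
  set ω : ℂ := ((Real.pi : ℝ) : ℂ) with hωdef
  have hinj : Function.Injective (Polynomial.aeval ω : ℚ[X] →ₐ[ℚ] ℂ) :=
    transcendental_iff_injective.mp hω
  -- `ω, ω²` are `ℚ`-linearly independent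
  have hlin : LinearIndependent ℚ ![ω, ω ^ 2] := by
    rw [LinearIndependent.pair_iff]
    intro s t hst
    have hp : Polynomial.aeval ω (Polynomial.C s * Polynomial.X + Polynomial.C t * Polynomial.X ^ 2)
        = s • ω + t • ω ^ 2 := by
      simp only [map_add, map_mul, Polynomial.aeval_C, Polynomial.aeval_X, map_pow,
        Algebra.smul_def]
    have hzero : Polynomial.C s * Polynomial.X + Polynomial.C t * Polynomial.X ^ 2 = 0 :=
      hinj (by rw [hp, hst, map_zero])
    constructor
    · have h := congrArg (fun p : ℚ[X] => p.coeff 1) hzero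
      simpa [Polynomial.coeff_X_pow, Polynomial.coeff_C_mul, Polynomial.coeff_X] using h
    · have h := congrArg (fun p : ℚ[X] => p.coeff 2) hzero
      simpa [Polynomial.coeff_X_pow, Polynomial.coeff_C_mul, Polynomial.coeff_X] using h
  -- `1 ± ω ≠ 0`
  have hne1 : 1 + ω ≠ 0 := by
    intro h
    apply hω
    have : ω = algebraMap ℚ ℂ (-1) := by
      rw [map_neg, map_one]; linear_combination h
    rw [this]; exact isAlgebraic_algebraMap _
  have hne2 : 1 - ω ≠ 0 := by
    intro h
    apply hω
    have : ω = algebraMap ℚ ℂ 1 := by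
      rw [map_one]; linear_combination -h
    rw [this]; exact isAlgebraic_algebraMap _
  -- `trdeg_ℚ ℚ(ω) ≤ 1`
  have htr1 : Algebra.trdeg ℚ ↥(IntermediateField.adjoin ℚ ({ω} : Set ℂ)) ≤ 1 := by
    classical
    open scoped IntermediateField.algebraAdjoinAdjoin in
    let Lt : IntermediateField ℚ ℂ := IntermediateField.adjoin ℚ ({ω} : Set ℂ)
    let t' : Lt := ⟨ω, IntermediateField.mem_adjoin_simple_self ℚ ω⟩
    have hmap : Subalgebra.map Lt.val (Algebra.adjoin ℚ ({t'} : Set Lt)) =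
        Algebra.adjoin ℚ ({ω} : Set ℂ) := by
      rw [AlgHom.map_adjoin, Set.image_singleton]
      rfl
    let e : Algebra.adjoin ℚ ({t'} : Set Lt) ≃ₐ[ℚ] Algebra.adjoin ℚ ({ω} : Set ℂ) :=
      (Subalgebra.equivMapOfInjective _ Lt.val Subtype.val_injective).trans
        (Subalgebra.equivOfEq _ _ hmap)
    haveI : Algebra.IsAlgebraic (Algebra.adjoin ℚ ({t'} : Set Lt)) Lt := by
      refine ⟨fun y => ?_⟩
      have hy : IsAlgebraic (Algebra.adjoin ℚ ({ω} : Set ℂ)) (y : Lt) :=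
        Algebra.IsAlgebraic.isAlgebraic y
      refine IsAlgebraic.of_ringHom_of_comp_eq (e : _ →+* _) (RingHom.id Lt) (by simpa using hy)
        e.surjective Function.injective_id ?_
      ext x
      rfl
    have h := Algebra.IsAlgebraic.trdeg_le_cardinalMk (R := ℚ) ({t'} : Set Lt)
    simpa using h
  -- the point has transcendence degree `< 2` (indeed `ℚ(y, α) = ℚ(ω)`)
  have htr : Algebra.trdeg ℚ ↥(IntermediateField.adjoin ℚ
      (Set.range ![ω, ω ^ 2] ∪ Set.range ![1 + ω, 1 - ω])) < ((2 : ℕ) : Cardinal) := by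
    set L := IntermediateField.adjoin ℚ (Set.range ![ω, ω ^ 2] ∪ Set.range ![1 + ω, 1 - ω])
      with hL
    set K := IntermediateField.adjoin ℚ ({ω} : Set ℂ) with hK
    have hωK : ω ∈ K := IntermediateField.mem_adjoin_simple_self ℚ ω
    have hle : L ≤ K := by
      rw [hL, IntermediateField.adjoin_le_iff]
      rintro x (⟨j, rfl⟩ | ⟨j, rfl⟩) <;> fin_cases j
      · exact hωK
      · exact pow_mem hωK 2
      · exact add_mem (one_mem K) hωK
      · exact sub_mem (one_mem K) hωK
    have h1 : Algebra.trdeg ℚ L ≤ Algebra.trdeg ℚ K :=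
      trdeg_le_of_injective (IntermediateField.inclusion hle)
        (IntermediateField.inclusion_injective hle)
    calc Algebra.trdeg ℚ L ≤ 1 := h1.trans htr1
      _ < ((2 : ℕ) : Cardinal) := by exact_mod_cast (by decide : (1 : ℕ) < 2)
  -- conclude
  obtain ⟨s₀, s₁, t₀, t₁, u, hadm, hfreq⟩ := hX 2 ![ω, ω ^ 2] ![1 + ω, 1 - ω] hlin
    (fun j => by
      fin_cases j
      · simpa using hne1
      · simpa using hne2)
    htr
  exact noCheap ω hω ![Polynomial.X, Polynomial.X ^ 2]
    ![1 + Polynomial.X, 1 - Polynomial.X] (fun j => by fin_cases j <;> simp)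
    (fun j => by fin_cases j <;> simp) ![ω, ω ^ 2] ![1 + ω, 1 - ω]
    (fun j => by fin_cases j <;> simp) (fun j => by fin_cases j <;> simp) hadm hfreq

end Summit.Schanuel.Schanuel.Theorems

end
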